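import Summits.ResolutionOfSingularities.ResolutionOfSingularities.Theorems.WildConesClassicalRegimesDefs
import Literature.AlgebraicGeometry.Resolution.MvPowerSeriesChainRule
import Mathlib.RingTheory.LocalRing.MaximalIdeal.Basic
import Mathlib.RingTheory.MvPowerSeries.Inverse
import Mathlib.LinearAlgebra.Dimension.Finrank
import HarnessLib

/-!
# [OURS · L1 W4.6, rung (ii) at p = 2, every dimension] DEFINITIONS: the embedding dimension of the
# Milnor algebra of a state of route WildCones' point-blow-up dynamics (the CORANK of the polar form of a
# double point in characteristic two) — campaign s46 of cell res-hironaka (LADDER-RESOLUTION rung L, D-0089)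

HONEST FRAMING. Everything below is OURS (campaign bookkeeping of slot W4.6 «restricted regimes as rungs»,
seat res-L1-s46-pv-4 gen 3, target «(ii) threefold hypersurfaces, the `p = 2` hyperbolic-splitting regime of
`ClassicalRegimes` (n ≥ 3, order-2 cleaned states)»): two numerical invariants of route WildCones' TYPED
point-blow-up dynamics (`Theorems/WildConesClassicalRegimesDefs.lean`: a state is the coefficient function
`c` of `a = Σ c(A) u^A`, the atom is `z^p = a(u₁,…,uₙ)`; `jac c = (∂₁a,…,∂ₙa)`, `Isol c` = finite Milnor
algebra `κ⟦u⟧/(∂a)`, `mu c` = its `κ`-dimension). No theorem, no `sorry`. NOTHING here is a statement of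
the manuscript [Hironaka2017]; nothing of it is used; no FACT-LIST premise is used. AI bookkeeping, weaker
than expert review.

WHAT AND WHY. The sequel files `Theorems/WildConesCampaignW46HypersurfacesCharTwoEmbDim*.lean` extend the
seat's `n = 3` picture (p479260 … p485613: closure of the order-2-cleaned regime `MultP ∧ OrdP ∧ Isol`, the
isolated/non-isolated dichotomy, parity of `μ`, the Milnor algebra `κ⟦X⟧/(X^μ)`, resolution within `μ/2`)
to EVERY dimension `n`. In dimension `n ≥ 4` the order predicate `OrdP` (one hyperbolic pair `u_j u_l` in
the cleaned quadratic form) is no longer the right regime — closure fails for `n = 4, 5` (p485483, p484275).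
The right regime is cut out by ONE number, defined here:

* `CampaignW46.jetTwoColength f` — for a formal power series `f ∈ κ⟦X₁,…,Xₙ⟧`: the colength
  `dim_κ κ⟦X⟧ / ((∂₁f,…,∂ₙf) + 𝔪²)`, i.e. `dim_κ A/𝔪_A²` for the Milnor algebra `A = κ⟦X⟧/(∂f)` when
  `(∂f) ⊆ 𝔪` — one more than the EMBEDDING DIMENSION of `A`;
* `CampaignW46.milnorEmbDim p n κ c := jetTwoColength (ser p n κ c) - 1` — for a state `c` of the
  dynamics: the embedding dimension `e(c) = dim_κ 𝔪_A/𝔪_A²` of its Milnor algebra `A = κ⟦u⟧/(∂a)`,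
  equivalently `n − rank_κ ⟨linear parts of ∂₁a, …, ∂ₙa⟩`. For a DOUBLE point in characteristic `2`
  (`a` cleaned of squares, order `≥ 2`) the linear part of `∂ₛa` is the `s`-th row of the alternating
  («polar») matrix `(q_{st})_{s ≠ t}` of the quadratic form `Σ_{s<t} q_{st} u_s u_t` of `a`, so `e(c)` is
  the CORANK OF THE POLAR FORM; `e(c) ≤ 1` («curvilinear Milnor algebra», polar form of corank `≤ 1`) is
  the hyperbolic-splitting regime in dimension `n`, and for `n = 3` it is `OrdP` (proved in the sequel).

VACUITY. Not vacuous and not constant: over `𝔽₂`, `e = 1` for `z² = u₀u₁ + u₂^(2j+1)` (`n = 3`, p470498's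
family), `e = 2` for `z² = u₀u₁ + u₂⁵ + u₃⁵` (`n = 4`, p485483), `e = 3` for `z² = u₀u₁ + u₂³ + u₃³ + u₄³`
(`n = 5`, p484275) and for the Fermat cubic (`n = 3`, p483423); the sequel proves `e ≡ n (mod 2)` and
`0 ≤ e ≤ n` for every double point.

## References

* res-L1-s46-pv-4 gens 0–2, files `Theorems/WildConesCampaignW46ThreefoldsCharTwo*.lean`,
  `…HypersurfacesCharTwo{Fourfold,Fivefold}NonClosure.lean` (all ACCEPTED, --supports stmt-16884); route
  file `Theses/WildCones.lean` (`ClassicalRegimes`, stmt-ResolutionOfSingularities-16884).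
* G.-M. Greuel, G. Pfister, The splitting lemma in any characteristic, J. Algebra 689 (2026)
  [GreuelPfister2026], Thm 3.5 / Cor 3.7 — context (the tree's `WildCones.MuDropCharTwoOrdP.pair_reduction`),
  not a premise here.
* H. Hironaka, ms. 2017-03-23 [Hironaka2017]: Th. 16.6 p.84, Th. 16.13 p.87 — quoted for the ROLE the sequel
  replaces only, under adjudication, not cited as fact.
-/

noncomputable section

set_option linter.dupNamespace false -- mandated namespace of this single-conjunct summit

open scoped Classical

open MvPowerSeries IsLocalRing

open Literature.AlgebraicGeometry.Resolution

namespace Summit.ResolutionOfSingularities.ResolutionOfSingularities.Theorems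

namespace CampaignW46

/-- [OURS · L1 W4.6; NOT a statement of the manuscript] **The colength of the 2-jet of the gradient
ideal**: for `f ∈ κ⟦X₁,…,Xₙ⟧`, `jetTwoColength f = dim_κ κ⟦X⟧ / ((∂₁f,…,∂ₙf) + 𝔪²)`. When the partials
lie in the maximal ideal `𝔪` (e.g. `ord f ≥ 2`) this is `dim_κ A/𝔪_A² = 1 + edim A` for the Milnor algebra
`A = κ⟦X⟧/(∂f)`, and equals `n + 1 − rank_κ` of the linear parts of the partials. [folklore] -/
def jetTwoColength {n : ℕ} {κ : Type} [Field κ] (f : MvPowerSeries (Fin n) κ) : ℕ :=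
  Module.finrank κ (MvPowerSeries (Fin n) κ ⧸
    (Ideal.span (Set.range fun s : Fin n => MvPowerSeries.pderiv s f) ⊔
      maximalIdeal (MvPowerSeries (Fin n) κ) ^ 2))

/-- [OURS · L1 W4.6; NOT a statement of the manuscript] **The embedding dimension of the Milnor algebra
of a state** of route WildCones' point-blow-up dynamics (`z^p = a(u₁,…,uₙ)`, `a = ser p n κ c` the
cleaned series): `e(c) = dim_κ 𝔪_A/𝔪_A²` for `A = κ⟦u⟧/(∂₁a,…,∂ₙa)`, computed as `jetTwoColength a - 1`;
equivalently `n −` the `κ`-rank of the linear parts of the partials `∂ₛa`. For a double point in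
characteristic `2` this is the CORANK OF THE POLAR (alternating) FORM `(q_{st})_{s≠t}` of the cleaned
quadratic part `Σ_{s<t} q_{st} u_s u_t`; the hyperbolic-splitting regime in dimension `n` is `e(c) ≤ 1`.
[folklore] -/
def milnorEmbDim (p n : ℕ) (κ : Type) [Field κ] (c : (Fin n → ℕ) → κ) : ℕ :=
  jetTwoColength (WildCones.ser p n κ c) - 1

end CampaignW46

end Summit.ResolutionOfSingularities.ResolutionOfSingularities.Theorems

end
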